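/-
Copyright: the b2b-balaban cell (near-miss cell 7), T⁴-continuum fan-out; row NE7b ROUND-2 swarm, seat
t4-ne7b-formalise-leaf-10 (gen 3; sub-row S6g′(f) of `t4/b2b-balaban-t4-ne7b-p1/LEAVES-NE7b.md`, owner's ruling
R-OWNER-22-12 (2); sequel of `HistorySiblingEntropy` (e) and of this lineage's finding F-leaf10-3).
Released under the licence of the surrounding project.
-/
import Summits.QuantumFields.BalabanUV.T4Continuum.Support.HistorySiblingEntropy

/-!
# Sibling entropy bound, part 1: ABSTRACT SHAPES, their budget `Φ`, their entropy, and the exact recursion of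
# `G := C·Φ − ent` at a join (row S6g′(f))

Summits-side support leaf of the T⁴-continuum cell (rung (B)+1 on a FINITE torus only; NOT infinite volume, NOT the
mass gap, NOT the Clay statement; NOT a proof of the spine estimate NE7b).  Row NE7b, route «COUNT», row S6g′
«MASS-BASED SIBLING COUNT» (R-OWNER-22-12 (2)).  [folklore] finite combinatorics over an ABSTRACT shape type (Mathlib +
`HistorySiblingEntropy` only); nothing is quoted from print, nothing printed is asserted, no `[cite:]` tag, no `Prop`
fact minted.

WHY (the three parts together).  `HistorySiblingEntropy` (e) reduced the residual of the mass-based sibling count to the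
SIBLING ENTROPY `Σ_joins log(K_H!∕∏_g k_g!)` of the member's shape tree (classes `g` = equal non-host parts of a join),
and F-leaf10-3 showed that no RANK built from the per-part data (age, root fatness, mass) bounds it.  Parts 1–3 prove the
bound all the same, by a Kraft∕Gibbs argument: for shape trees whose joins carry their non-host parts as a MULTISET (a
canonically SORTED list) the sibling entropy is at most `C·Φ` with the ABSOLUTE constant `C = 2` (natural logarithms;
any `C ≥ 2`), `Φ = Σ_births (1 + fat) + Σ_joins Σ_{non-host parts} (age + 1)` — class-linear in the G-junction's
currency (`≤ C·F + 2C·partnerAges`: `age ≥ 1`, and the non-host ages of the joins sum to `partnerAges` by the tournament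
identity `HistoryJoins.partnerAges_add_eq_sum_clusterParts`).

WHAT (this part).  §1 the shapes (`Shape`∕`Parts`: `atom root fat`, `join step host parts`), `root`, `last`, `nodes`, `phi`,
`ent` (a join's entropy `Parts.lmult` = `HistorySiblingEntropy.logMultinomial` of its part list), `WF` (chronology: at a
join of step `s` the host's and the parts' events are `< s`, and there is a part), `Canon` (every part list sorted by a
fixed injection `enc : Shape → ℕ`, i.e. read as a multiset), list characterisations.  §2 `G`, the candidate-part weight
`wt = e^{−G − C(age+1)}`, the exact recursion **`G_join`** ∕ **`exp_neg_G_join`** (`e^{−G(join)} = e^{−G(host)} ·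
multinomial · ∏ wt^{count}` over any finite superset of the parts) and canonical injectivity **`parts_eq_of_count_eq`**;
accessors `host`∕`parts`∕`fat`∕`isAtom`.  Part 2 `HistorySiblingEntropyJoins`: the joins of one step against their hosts;
part 3 `HistorySiblingEntropyBound`: the Kraft sum and the bound `ent ≤ 2·Φ`.

HONEST SCOPE.  An abstract theorem about OUR bookkeeping; its USE needs the bridge «sub-structure of a tagged genealogy
with its cluster parts (`HistoryJoins.jparts`) ↦ `Shape`» identifying leaf-05's classes (`HistoryJoinsAdm.key`: equal
ORDERED sub-structures) with equal shapes, which holds iff the ENCODING CONVENTION «each cluster lists its non-host parts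
in a canonical shape-first order» is adopted — the owner's to rule (journal l.9428).  Nothing of print is asserted;
nothing of H3∕(B)∕BetaPertH is touched.  NE7b NOT proved.  HONEST DEPENDENCY (cell): continuum YM on T⁴ ⇐ BetaPertH ∧
nine spine estimates (0/9 proved); BetaPertH ⇐ (D1) ∧ (D4) ∧ CAP+tail; G-an2-4 gates asym, D1 and NE2/3/4.  This file
changes none of it.
-/

open Finset

namespace Summit.QuantumFields.BalabanUV.T4Continuum.HistorySiblingEntropyBound

open Summit.QuantumFields.BalabanUV.T4Continuum.HistorySiblingEntropy
open Summit.QuantumFields.BalabanUV.T4Continuum.HistorySiblingMass (class_cost_le)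

/-! ## §1 Abstract shapes -/

mutual
/-- **ABSTRACT SHAPE TREES**: a bare birth `atom r f` (root step `r`, fatness `f`; its renewal chain is determined and
not recorded), or a join `join s h ps` at step `s` of a host `h` with the non-host parts `ps`. [folklore] -/
inductive Shape : Type
  | atom : ℕ → ℕ → Shape
  | join : ℕ → Shape → Parts → Shape
/-- the non-host parts of a join (a list; canonical shapes have it SORTED, i.e. read as a multiset) [folklore] -/
inductive Parts : Type
  | nil : Parts
  | cons : Shape → Parts → Parts
end
deriving instance DecidableEq for Shape
deriving instance Countable for Shape

/-- the parts as a list [folklore] -/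
def Parts.toList : Parts → List Shape
  | .nil => []
  | .cons x ps => x :: ps.toList

/-- equal lists, equal parts [folklore] -/
theorem Parts.eq_of_toList_eq : ∀ {ps qs : Parts}, ps.toList = qs.toList → ps = qs
  | .nil, .nil, _ => rfl
  | .nil, .cons _ _, h => by simp [Parts.toList] at h
  | .cons _ _, .nil, h => by simp [Parts.toList] at h
  | .cons x ps, .cons y qs, h => by
      simp only [Parts.toList, List.cons.injEq] at h
      rw [h.1, Parts.eq_of_toList_eq h.2]

/-- `toList` is injective [folklore] -/
theorem Parts.toList_injective : Function.Injective Parts.toList := fun _ _ h => Parts.eq_of_toList_eq h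

/-- root step: the step of the oldest birth (the host chain ends in it) [folklore] -/
def Shape.root : Shape → ℕ
  | .atom r _ => r
  | .join _ h _ => h.root

/-- last event step [folklore] -/
def Shape.last : Shape → ℕ
  | .atom r _ => r
  | .join s _ _ => s

mutual
/-- number of births and joins [folklore] -/
def Shape.nodes : Shape → ℕ
  | .atom _ _ => 1
  | .join _ h ps => h.nodes + ps.nodes + 1
/-- total node count of the parts [folklore] -/
def Parts.nodes : Parts → ℕ
  | .nil => 0
  | .cons x ps => x.nodes + ps.nodes
end

mutual
/-- **THE BUDGET `Φ`**: `1 + fat` per birth; `age + 1` per non-host part of a join (`age = s + 1 − root`). [folklore] -/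
def Shape.phi : Shape → ℕ
  | .atom _ f => 1 + f
  | .join s h ps => h.phi + ps.phi s
/-- the parts' share of `Φ` at a join of step `s` [folklore] -/
def Parts.phi (s : ℕ) : Parts → ℕ
  | .nil => 0
  | .cons x ps => x.phi + (s + 1 - x.root) + 1 + ps.phi s
end

/-- **THE ENTROPY OF ONE JOIN**: the log-multinomial of the class sizes of its part list (classes = equal parts).
[folklore] -/
noncomputable def Parts.lmult (ps : Parts) : ℝ :=
  logMultinomial ps.toList.toFinset fun x => ps.toList.count x

mutual
/-- **THE SIBLING ENTROPY** of a shape: the sum over its joins of the joins' entropies. [folklore] -/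
noncomputable def Shape.ent : Shape → ℝ
  | .atom _ _ => 0
  | .join _ h ps => h.ent + ps.entSum + ps.lmult
/-- the parts' internal entropies [folklore] -/
noncomputable def Parts.entSum : Parts → ℝ
  | .nil => 0
  | .cons x ps => x.ent + ps.entSum
end

mutual
/-- **CHRONOLOGY**: at a join of step `s` the host's and the parts' events are earlier than `s`, and there is a part.
[folklore] -/
def Shape.WF : Shape → Prop
  | .atom _ _ => True
  | .join s h ps => h.WF ∧ h.last < s ∧ ps ≠ .nil ∧ ps.WF s
/-- chronology of the parts of a join of step `s` [folklore] -/
def Parts.WF (s : ℕ) : Parts → Prop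
  | .nil => True
  | .cons x ps => x.WF ∧ x.last < s ∧ ps.WF s
end

/-- a fixed injection of the shapes into `ℕ` (the canonical order) [folklore] -/
noncomputable def enc : Shape → ℕ := (Countable.exists_injective_nat Shape).choose

/-- `enc` is injective [folklore] -/
theorem enc_injective : Function.Injective enc := (Countable.exists_injective_nat Shape).choose_spec

mutual
/-- **CANONICAL SHAPES**: every part list is sorted by `enc` (so it is determined by its multiset), recursively.
[folklore] -/
def Shape.Canon : Shape → Prop
  | .atom _ _ => True
  | .join _ h ps => h.Canon ∧ ps.Canon ∧ ps.toList.Pairwise fun x y => enc x ≤ enc y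
/-- all parts canonical [folklore] -/
def Parts.Canon : Parts → Prop
  | .nil => True
  | .cons x ps => x.Canon ∧ ps.Canon
end

/-! ### The list characterisations -/

/-- `Parts.nodes` is the sum over the list [folklore] -/
theorem Parts.nodes_eq_sum : ∀ ps : Parts, ps.nodes = (ps.toList.map Shape.nodes).sum
  | .nil => rfl
  | .cons x ps => by simp [Parts.nodes, Parts.toList, Parts.nodes_eq_sum ps]

/-- `Parts.phi` is the sum over the list [folklore] -/
theorem Parts.phi_eq_sum (s : ℕ) : ∀ ps : Parts, ps.phi s = (ps.toList.map fun x => x.phi + (s + 1 - x.root) + 1).sum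
  | .nil => rfl
  | .cons x ps => by simp [Parts.phi, Parts.toList, Parts.phi_eq_sum s ps]

/-- `Parts.entSum` is the sum over the list [folklore] -/
theorem Parts.entSum_eq_sum : ∀ ps : Parts, ps.entSum = (ps.toList.map Shape.ent).sum
  | .nil => rfl
  | .cons x ps => by simp [Parts.entSum, Parts.toList, Parts.entSum_eq_sum ps]

/-- `Parts.WF` memberwise [folklore] -/
theorem Parts.wf_iff (s : ℕ) : ∀ ps : Parts, ps.WF s ↔ ∀ x ∈ ps.toList, x.WF ∧ x.last < s
  | .nil => by simp [Parts.WF, Parts.toList]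
  | .cons x ps => by simp [Parts.WF, Parts.toList, Parts.wf_iff s ps, and_assoc]

/-- `Parts.Canon` memberwise [folklore] -/
theorem Parts.canon_iff : ∀ ps : Parts, ps.Canon ↔ ∀ x ∈ ps.toList, x.Canon
  | .nil => by simp [Parts.Canon, Parts.toList]
  | .cons x ps => by simp [Parts.Canon, Parts.toList, Parts.canon_iff ps]

/-- a nonempty part list has a nonempty list [folklore] -/
theorem Parts.toList_ne_nil {ps : Parts} (h : ps ≠ .nil) : ps.toList ≠ [] := by
  cases ps with
  | nil => exact absurd rfl h
  | cons x ps => simp [Parts.toList]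

/-- the root is not after the last event [folklore] -/
theorem Shape.root_le_last : ∀ {g : Shape}, g.WF → g.root ≤ g.last
  | .atom _ _, _ => le_rfl
  | .join s h ps, hw => by
      have := Shape.root_le_last hw.1
      simp only [Shape.root, Shape.last]
      have h2 : h.last < s := hw.2.1
      omega

/-- every shape has a node [folklore] -/
theorem Shape.one_le_nodes : ∀ g : Shape, 1 ≤ g.nodes
  | .atom _ _ => le_rfl
  | .join _ _ _ => by simp [Shape.nodes]

/-- a part has fewer nodes than the join [folklore] -/
theorem Shape.nodes_lt_of_mem {s : ℕ} {h : Shape} {ps : Parts} {x : Shape} (hx : x ∈ ps.toList) :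
    x.nodes < (Shape.join s h ps).nodes := by
  have : x.nodes ≤ ps.nodes := by
    rw [Parts.nodes_eq_sum]
    exact List.single_le_sum (fun _ _ => Nat.zero_le _) _ (List.mem_map.2 ⟨x, hx, rfl⟩)
  simp only [Shape.nodes]; omega

/-- the host has fewer nodes than the join [folklore] -/
theorem Shape.nodes_host_lt (s : ℕ) (h : Shape) (ps : Parts) : h.nodes < (Shape.join s h ps).nodes := by
  simp only [Shape.nodes]; omega

/-! ## §2 The exact recursion and canonical injectivity -/

noncomputable section

/-- the potential `G := C·Φ − ent` [folklore] -/
def G (C : ℝ) (g : Shape) : ℝ := C * g.phi - g.ent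

/-- the weight of a candidate non-host part `x` at a join of step `s`: `e^{−G x − C·(age + 1)}`, `age = s + 1 − root x`
[folklore] -/
def wt (C : ℝ) (s : ℕ) (x : Shape) : ℝ := Real.exp (-(G C x + C * ((s + 1 - x.root : ℕ) + 1)))

/-- weights are positive [folklore] -/
theorem wt_pos (C : ℝ) (s : ℕ) (x : Shape) : 0 < wt C s x := Real.exp_pos _

/-- **THE EXACT RECURSION OF `G` AT A JOIN**:
`G (join s h ps) = G h + Σ_{x ∈ parts} (G x + C·(age x + 1)) − lmult ps`. [folklore] -/
theorem G_join (C : ℝ) (s : ℕ) (h : Shape) (ps : Parts) :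
    G C (Shape.join s h ps) =
      G C h + (ps.toList.map fun x => G C x + C * ((s + 1 - x.root : ℕ) + 1)).sum - ps.lmult := by
  simp only [G, Shape.phi, Shape.ent, Parts.phi_eq_sum, Parts.entSum_eq_sum]
  have key : ∀ l : List Shape,
      (C * ((l.map fun x => x.phi + (s + 1 - x.root) + 1).sum : ℕ) - (l.map Shape.ent).sum : ℝ) =
        (l.map fun x => C * (x.phi : ℝ) - x.ent + C * ((s + 1 - x.root : ℕ) + 1)).sum := by
    intro l
    induction l with
    | nil => simp
    | cons x l ih =>
        simp only [List.map_cons, List.sum_cons, Nat.cast_add, Nat.cast_one]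
        rw [← ih]; ring
  have := key ps.toList
  push_cast at this ⊢
  linarith

/-- the sum over a list as a count-weighted sum over any finite superset of its elements [folklore] -/
theorem list_sum_eq_sum_count {U : Finset Shape} {l : List Shape} (hU : l.toFinset ⊆ U) (f : Shape → ℝ) :
    (l.map f).sum = ∑ x ∈ U, (l.count x : ℝ) * f x := by
  classical
  have h1 : (l.map f).sum = ∑ x ∈ l.toFinset, (l.count x) • f x := by
    have h := Finset.sum_multiset_map_count (l : Multiset Shape) f
    rw [Multiset.map_coe, Multiset.sum_coe] at h
    simp only [Multiset.coe_count] at h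
    exact h
  rw [h1]
  rw [← sum_subset hU]
  · exact sum_congr rfl fun x _ => by rw [nsmul_eq_mul]
  · intro x _ hx
    rw [List.mem_toFinset] at hx
    simp [List.count_eq_zero.2 hx]

/-- the multinomial coefficient over a superset with zero counts outside [folklore] -/
theorem multinomial_superset {U : Finset Shape} {l : List Shape} (hU : l.toFinset ⊆ U) :
    Nat.multinomial U (fun x => l.count x) = Nat.multinomial l.toFinset (fun x => l.count x) := by
  classical
  have h0 : ∀ x ∈ U, x ∉ l.toFinset → l.count x = 0 := fun x _ hx =>
    List.count_eq_zero.2 (fun hm => hx (List.mem_toFinset.2 hm))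
  unfold Nat.multinomial
  rw [← sum_subset hU h0, ← prod_subset hU (fun x hxU hx => by simp [h0 x hxU hx])]

/-- **THE WEIGHT OF A JOIN FACTORISES**: for any finite `U` containing the parts,
`e^{−G (join s h ps)} = e^{−G h} · multinomial U count · ∏_{x ∈ U} (wt x)^{count x}`. [folklore] -/
theorem exp_neg_G_join (C : ℝ) (s : ℕ) (h : Shape) (ps : Parts) {U : Finset Shape} (hU : ps.toList.toFinset ⊆ U) :
    Real.exp (-G C (Shape.join s h ps)) =
      Real.exp (-G C h) * (Nat.multinomial U (fun x => ps.toList.count x) : ℝ) *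
        ∏ x ∈ U, wt C s x ^ ps.toList.count x := by
  classical
  rw [G_join, list_sum_eq_sum_count hU]
  have hl : ps.lmult = Real.log (Nat.multinomial U (fun x => ps.toList.count x) : ℝ) := by
    rw [Parts.lmult, logMultinomial_eq_log_multinomial, multinomial_superset hU]
  rw [hl]
  have hm : (0 : ℝ) < (Nat.multinomial U (fun x => ps.toList.count x) : ℝ) := by
    exact_mod_cast Nat.multinomial_pos _ _
  rw [show -(G C h + ∑ x ∈ U, (ps.toList.count x : ℝ) * (G C x + C * ((s + 1 - x.root : ℕ) + 1)) -
      Real.log (Nat.multinomial U (fun x => ps.toList.count x) : ℝ)) =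
      -G C h + Real.log (Nat.multinomial U (fun x => ps.toList.count x) : ℝ) +
        ∑ x ∈ U, (ps.toList.count x : ℝ) * (-(G C x + C * ((s + 1 - x.root : ℕ) + 1))) by
    rw [sum_congr rfl fun x _ => (mul_neg _ _)]; rw [sum_neg_distrib]; ring]
  rw [Real.exp_add, Real.exp_add, Real.exp_log hm, Real.exp_sum]
  congr 1
  refine prod_congr rfl fun x _ => ?_
  rw [wt, ← Real.exp_nat_mul]

/-- `enc`-sortedness is antisymmetric enough: two sorted lists with the same counts are equal [folklore] -/
theorem list_eq_of_count_eq {l l' : List Shape} (hs : l.Pairwise fun x y => enc x ≤ enc y)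
    (hs' : l'.Pairwise fun x y => enc x ≤ enc y) (hc : ∀ x, l.count x = l'.count x) : l = l' := by
  have hp : l.Perm l' := List.perm_iff_count.2 hc
  exact hp.eq_of_pairwise (fun a b _ _ h1 h2 => enc_injective (le_antisymm h1 h2)) hs hs'

/-- **CANONICAL INJECTIVITY**: two canonical joins with the same step, the same host and the same part COUNTS are equal.
[folklore] -/
theorem parts_eq_of_count_eq {s : ℕ} {h : Shape} {ps ps' : Parts} (hc : (Shape.join s h ps).Canon)
    (hc' : (Shape.join s h ps').Canon) (h : ∀ x, ps.toList.count x = ps'.toList.count x) : ps = ps' :=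
  Parts.toList_injective (list_eq_of_count_eq hc.2.2 hc'.2.2 h)


/-! ### Accessors -/

/-- the host of a join (an atom is its own host) [folklore] -/
def Shape.host : Shape → Shape
  | .atom r f => .atom r f
  | .join _ h _ => h

/-- the parts of a join (none for an atom) [folklore] -/
def Shape.parts : Shape → Parts
  | .atom _ _ => .nil
  | .join _ _ ps => ps

/-- the fatness of an atom (`0` on joins) [folklore] -/
def Shape.fat : Shape → ℕ
  | .atom _ f => f
  | .join _ _ _ => 0

/-- atoms [folklore] -/
def Shape.isAtom : Shape → Bool
  | .atom _ _ => true
  | .join _ _ _ => false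

/-- an atom is `atom root fat` [folklore] -/
theorem Shape.eq_atom {g : Shape} (hg : g.isAtom = true) : g = .atom g.root g.fat := by
  cases g with
  | atom r f => rfl
  | join s h ps => simp [Shape.isAtom] at hg

/-- a join is `join last host parts` [folklore] -/
theorem Shape.eq_join {g : Shape} (hg : g.isAtom = false) : g = .join g.last g.host g.parts := by
  cases g with
  | atom r f => simp [Shape.isAtom] at hg
  | join s h ps => rfl

end

end Summit.QuantumFields.BalabanUV.T4Continuum.HistorySiblingEntropyBound
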